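/-
Copyright (c) 2026 the pub-hodgecm-mathlib formalisation cell (harness21).  Prover seat hodgecm-mathlib-A-p03 (g25); road «R1LL-tree» (architect A-p16 (g27), RULINGS A-2 (b) ∕ A-3 (a);
LEAD F0P3a-plan (g10)), brick I-5a FILE A «eigenframes of rank-2 unitary elements: the split torus fixes a self-dual vertex», 2026-09-01.
-/
import Literature.NumberTheory.Automorphic.SelfDualStableLatticeInteriorCount        -- ★ (R4): `det_eq_mul_of_mul_eigenframe_two`, `mem_glInt_of_isIntegralMatrix`, `glInt`
import Literature.NumberTheory.Automorphic.SelfDualLatticeCountFrameTransport         -- ★ (L5-d1): `formCongr_mul`, `inv_mul_mul_eq_diagonal_of_eigenframe`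
import Literature.NumberTheory.Rogawski1990.LocalStableClassesNonsplit               -- ★ `twistGram` API (`twistGram_unitary_mul`, `det_twistGram`, `conjTranspose_twistGram`)
import HarnessLib

/-!
# Eigenframes of rank-2 unitary elements: the SPLIT TORUS fixes a self-dual vertex; `GL₂(𝒪)` bookkeeping for vertex lattices

Generic linear algebra over a field `K` with a ring endomorphism `σ` (an involution where said) and, in §2, a `ValuativeRel` — FILE A of brick I-5a «compact
elements of `U(Φ₂)(L⁺_v)` stabilise a vertex lattice» (FILE B = `UnitaryCompactElementVertexLattice`: the unitary transvection, the double root, and the CM-place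
head `exists_vertexFrame_of_trace_mem`).  Topic `NumberTheory/Automorphic`; namespace `Literature.NumberTheory.Automorphic`.  THEOREMS ONLY (no definition, no
instance, no notation, no named fact, no `sorry`); kernel lane.  Cell `pub/hodgecm-mathlib`, F0∕P3a, road «R1LL-tree» (architect A-p16 (g27)); HONEST LABEL: HC_CM is
proved only modulo the printed citations until rung 0 closes — nothing printed is asserted here.

TOKENS (the ★ `glInt` ∕ `formCongr` world of (L5) ∕ (R4) ∕ p842459; NO dual-lattice object): `Λ(g)` (columns of `g ∈ GL₂(K)`) is SELF-DUAL for `J` iff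
`∃ J′ ∈ glInt 2 K, ↑J′ = formCongr σ g J`; `γ · Λ(g) = Λ(g)` iff `g⁻¹ γ g ∈ glInt 2 K` (★ `map_span_range_transpose_eq_self_iff`).

* §1 FRAME ALGEBRA for `γ ∈ U(σ, H)` with an eigenframe `γ P = P · diag(u)`: `σ(det γ) det γ = 1`; the Gram matrix `G = ᵗσ(P) H P` satisfies
  **`G_ij = σ(u_i) · G_ij · u_j`** (`twistGram_apply_eq_of_eigenframe`), so `G_ij ≠ 0 ⟹ σ(u_i) u_j = 1` and `σ(u_i) u_i ≠ 1 ⟹ G_ii = 0` (an eigenvector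
  whose eigenvalue is not of norm one is ISOTROPIC); rank 2, `H` hermitian non-degenerate: a vanishing diagonal entry forces `G₀₁ ≠ 0`, and
  **`exists_formCongr_eq_antidiag_of_not_normOne`** — when `σ(u₀) u₀ ≠ 1` (the SPLIT torus `diag(a, σ(a)⁻¹)`), rescaling the second eigenvector by `G₀₁⁻¹`
  makes the Gram matrix the hyperbolic plane `antidiag(1, 1) = Φ₂` ITSELF; `tr γ = u₀ + u₁`; the hyperbolic pairing of `U(σ, Φ₂)` in coordinates.
* §2 VALUATION BOOKKEEPING: `|tr γ| ≤ 1`, `|det γ| = 1` ⟹ unit eigenvalues (`valuation_eq_one_of_eigenframe`); `Φ₂`, unit diagonal matrices and integral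
  companion matrices `[[0, −d], [1, t]]` lie in `GL₂(𝒪)`; `antidiag(β, σβ) = ϖ^e • J′` with `J′ ∈ GL₂(𝒪)` when `|β| = |ϖ^e|`; and the conclusion
  **`exists_formCongr_eq_antidiag_and_mem_glInt_of_not_normOne`**: the split torus with unit eigenvalues fixes a SELF-DUAL vertex
  (`∃ g, formCongr σ g H = Φ₂ ∧ g⁻¹ γ g ∈ GL₂(𝒪)`).

## References
* [Rogawski1990] J. D. Rogawski, *Automorphic Representations of Unitary Groups in Three Variables* (1990): §3.1 p. 19, §3.5 p. 29, §3.6 p. 31, §4.9 Lemma 4.9.3 p. 61.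
* [Serre1980Trees] J.-P. Serre, *Trees* (1980), Ch. II §1.2–§1.3 (vertices = lattice classes; the apartment of the split torus; bounded subgroups fix a vertex).
* [Jacobowitz1962] R. Jacobowitz, *Hermitian forms over local fields*, Amer. J. Math. 84 (1962), §7 (unimodular and modular lattices, unramified case).
* [Flicker1998UnitaryFL] Y. Z. Flicker, *The unitary fundamental lemma*, §6 p. 97 (the tree of `U(1,1)`).
-/

set_option autoImplicit false

noncomputable section

open scoped ValuativeRel Matrix MatrixGroups
open Matrix ValuativeRel
open Literature.AlgebraicGeometry.ShimuraVarieties (unitaryGroup mem_unitaryGroup_iff)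
open Literature.NumberTheory.Rogawski1990 (twistGram twistGram_def twistGram_mul twistGram_unitary_mul conjTranspose_twistGram det_twistGram)

namespace Literature.NumberTheory.Automorphic

variable {K : Type*} [Field K] (σ : K →+* K)

/-! ## §1 Generic frame algebra: the Gram matrix in an eigenframe of a unitary element -/

section Frame

variable {n : Type*} [Fintype n] [DecidableEq n]

/-- `det P ≠ 0` for `P ∈ GL_n(K)`. [cite: Rogawski1990, §3.1 p. 19] -/
private theorem det_val_ne_zero (P : GL n K) : (P : Matrix n n K).det ≠ 0 :=
  ((Matrix.isUnit_iff_isUnit_det _).1 P.isUnit).ne_zero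

/-- **`σ(det γ) · det γ = 1` for `γ ∈ U(σ, H)`** (`det H ≠ 0`): take determinants in `ᵗσ(γ) H γ = H`. [cite: Rogawski1990, §3.1 p. 19] -/
theorem map_det_mul_det_eq_one_of_mem_unitaryGroup {H : Matrix n n K} (hH : H.det ≠ 0) {γ : GL n K} (hγ : γ ∈ unitaryGroup σ H) :
    σ (γ : Matrix n n K).det * (γ : Matrix n n K).det = 1 := by
  have h := congrArg Matrix.det (mem_unitaryGroup_iff.1 hγ)
  rw [Matrix.det_mul, Matrix.det_mul, Matrix.det_transpose, ← RingHom.mapMatrix_apply, ← RingHom.map_det] at h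
  have h2 : σ (γ : Matrix n n K).det * (γ : Matrix n n K).det * H.det = 1 * H.det := by rw [one_mul]; linear_combination h
  exact mul_right_cancel₀ hH h2

/-- **`G_ij = σ(u_i) · G_ij · u_j`** for the Gram matrix `G = ᵗσ(P) H P` in an eigenframe `γ P = P · diag(u)` of `γ ∈ U(σ, H)`: compute `ᵗσ(γP) H (γP)` twice
(`= G` by unitarity, `= diag(σu) G diag(u)` by the eigen-equation). [cite: Rogawski1990, §3.5 p. 29; §3.6 p. 31] -/
theorem twistGram_apply_eq_of_eigenframe {H : Matrix n n K} {γ P : GL n K} {u : n → K} (hγ : γ ∈ unitaryGroup σ H)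
    (hP : (γ : Matrix n n K) * P = P * diagonal u) (i j : n) : twistGram σ H P.val i j = σ (u i) * twistGram σ H P.val i j * u j := by
  have h1 : twistGram σ H ((γ : Matrix n n K) * P) = twistGram σ H P.val := twistGram_unitary_mul σ H hγ _
  have h2 : twistGram σ H ((P : Matrix n n K) * diagonal u) = (diagonal fun m => σ (u m)) * twistGram σ H P.val * diagonal u := by
    rw [twistGram_mul, diagonal_map (map_zero σ), diagonal_transpose]
  rw [hP, h2] at h1
  have h := congrFun (congrFun h1 i) j
  rw [mul_diagonal, diagonal_mul] at h
  exact h.symm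

/-- **A non-zero Gram entry forces `σ(u_i) u_j = 1`** (cancel `G_ij` in `G_ij = σ(u_i) G_ij u_j`). [cite: Rogawski1990, §3.6 p. 31] -/
theorem map_mul_eq_one_of_twistGram_apply_ne_zero {H : Matrix n n K} {γ P : GL n K} {u : n → K} (hγ : γ ∈ unitaryGroup σ H)
    (hP : (γ : Matrix n n K) * P = P * diagonal u) {i j : n} (hij : twistGram σ H P.val i j ≠ 0) : σ (u i) * u j = 1 := by
  have h := twistGram_apply_eq_of_eigenframe σ hγ hP i j
  have h' : twistGram σ H P.val i j * (σ (u i) * u j) = twistGram σ H P.val i j * 1 := by rw [mul_one]; linear_combination -h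
  exact mul_left_cancel₀ hij h'

/-- **An eigenvector whose eigenvalue is NOT of norm one is isotropic**: `σ(u_i) u_i ≠ 1 ⟹ G_ii = 0`. [cite: Rogawski1990, §3.6 p. 31] [cite: Serre1980Trees, Ch. II §1.3] -/
theorem twistGram_apply_self_eq_zero_of_ne_one {H : Matrix n n K} {γ P : GL n K} {u : n → K} (hγ : γ ∈ unitaryGroup σ H)
    (hP : (γ : Matrix n n K) * P = P * diagonal u) {i : n} (hi : σ (u i) * u i ≠ 1) : twistGram σ H P.val i i = 0 := by
  by_contra hne
  exact hi (map_mul_eq_one_of_twistGram_apply_ne_zero σ hγ hP hne)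

/-- Rank 2: **if a diagonal Gram entry vanishes, the off-diagonal one does not** (`H` `σ`-hermitian non-degenerate, `σ` an involution: `G₁₀ = σ(G₀₁)` and
`det G = σ(det P) · det H · det P ≠ 0`). [cite: Rogawski1990, §3.5 p. 29] -/
theorem twistGram_apply_zero_one_ne_zero (hσσ : ∀ x, σ (σ x) = x) {H : Matrix (Fin 2) (Fin 2) K} (hH : (H.map σ)ᵀ = H) (hH0 : H.det ≠ 0)
    (P : GL (Fin 2) K) (h : twistGram σ H P.val 0 0 = 0 ∨ twistGram σ H P.val 1 1 = 0) : twistGram σ H P.val 0 1 ≠ 0 := by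
  intro h01
  have h10 : twistGram σ H P.val 1 0 = 0 := by
    have h' := congrFun (congrFun (conjTranspose_twistGram σ H hσσ hH P.val) 1) 0
    rw [transpose_apply, map_apply, h01, map_zero] at h'
    exact h'.symm
  have hdet : (twistGram σ H P.val).det = 0 := by
    rw [Matrix.det_fin_two, h01, h10, mul_zero, sub_zero]
    rcases h with h | h
    · rw [h, zero_mul]
    · rw [h, mul_zero]
  rw [det_twistGram] at hdet
  exact mul_ne_zero (mul_ne_zero ((map_ne_zero σ).2 (det_val_ne_zero P)) hH0) (det_val_ne_zero P) hdet

/-- **THE SPLIT-TORUS FRAME.**  `H` `σ`-hermitian with `det H ≠ 0`, `σ` an involution, `γ ∈ U(σ, H)` with an eigenframe `γ P = P · diag(u)`, `u` injective and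
`σ(u₀) u₀ ≠ 1`.  Then `G₀₀ = G₁₁ = 0`, `β := G₀₁ ≠ 0` (`σ(u₀) u₁ = 1`, so `u₁ = σ(u₀)⁻¹ ≠ u₀` rules out `σ(u₁) u₁ = 1`), and rescaling the second eigenvector by `β⁻¹`
makes the Gram matrix the hyperbolic plane `antidiag(1, 1)`: `∃ D = diag(c)`, `ᵗσ(PD) H (PD) = Φ₂` — the lattice `Λ(PD)` is a self-dual vertex of the apartment of
the split torus `{diag(a, σ(a)⁻¹)}`. [cite: Rogawski1990, §3.6 p. 31] [cite: Serre1980Trees, Ch. II §1.3] -/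
theorem exists_formCongr_eq_antidiag_of_not_normOne (hσσ : ∀ x, σ (σ x) = x) {H : Matrix (Fin 2) (Fin 2) K} (hH : (H.map σ)ᵀ = H) (hH0 : H.det ≠ 0)
    {γ P : GL (Fin 2) K} {u : Fin 2 → K} (hγ : γ ∈ unitaryGroup σ H) (hP : (γ : Matrix (Fin 2) (Fin 2) K) * P = P * diagonal u)
    (hu : Function.Injective u) (hN : σ (u 0) * u 0 ≠ 1) :
    ∃ (D : GL (Fin 2) K) (c : Fin 2 → K), (D : Matrix (Fin 2) (Fin 2) K) = diagonal c ∧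
      formCongr σ (P * D) H = Matrix.of fun i j : Fin 2 => if i.val + j.val + 1 = 2 then (1 : K) else 0 := by
  have h00 : twistGram σ H P.val 0 0 = 0 := twistGram_apply_self_eq_zero_of_ne_one σ hγ hP hN
  have hβ : twistGram σ H P.val 0 1 ≠ 0 := twistGram_apply_zero_one_ne_zero σ hσσ hH hH0 P (Or.inl h00)
  have h01u : σ (u 0) * u 1 = 1 := map_mul_eq_one_of_twistGram_apply_ne_zero σ hγ hP hβ
  have h11 : twistGram σ H P.val 1 1 = 0 := by
    refine twistGram_apply_self_eq_zero_of_ne_one σ hγ hP fun h11u => ?_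
    have hu1 : u 1 ≠ 0 := fun h0 => by
      rw [h0, mul_zero] at h01u
      exact zero_ne_one h01u
    have hσ01 : σ (u 0) = σ (u 1) := mul_right_cancel₀ hu1 (h01u.trans h11u.symm)
    have h01 : u 0 = u 1 := by rw [← hσσ (u 0), hσ01, hσσ]
    exact zero_ne_one (hu h01)
  have h10 : twistGram σ H P.val 1 0 = σ (twistGram σ H P.val 0 1) := by
    have h' := congrFun (congrFun (conjTranspose_twistGram σ H hσσ hH P.val) 1) 0
    rw [transpose_apply, map_apply] at h'
    exact h'.symm
  have hσβ : σ (twistGram σ H P.val 0 1) ≠ 0 := (map_ne_zero σ).2 hβ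
  have hdet : (diagonal ![(1 : K), (twistGram σ H P.val 0 1)⁻¹]).det ≠ 0 := by
    rw [det_diagonal, Fin.prod_univ_two]
    simp [hβ]
  refine ⟨Matrix.GeneralLinearGroup.mkOfDetNeZero _ hdet, ![1, (twistGram σ H P.val 0 1)⁻¹], Matrix.GeneralLinearGroup.val_mkOfDetNeZero _ hdet, ?_⟩
  rw [formCongr_mul]
  show ((((Matrix.GeneralLinearGroup.mkOfDetNeZero _ hdet : GL (Fin 2) K) : Matrix (Fin 2) (Fin 2) K)).map σ)ᵀ * twistGram σ H P.val *
      ((Matrix.GeneralLinearGroup.mkOfDetNeZero _ hdet : GL (Fin 2) K) : Matrix (Fin 2) (Fin 2) K) = _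
  rw [Matrix.GeneralLinearGroup.val_mkOfDetNeZero, diagonal_map (map_zero σ), diagonal_transpose]
  ext i j
  fin_cases i <;> fin_cases j <;> simp [Matrix.mul_apply, Fin.sum_univ_two, h00, h11, h10, hβ, hσβ]

omit [DecidableEq n] in
/-- **`tr γ = u₀ + u₁`** in an eigenframe `γ P = P · diag(u)` (rank 2). [cite: Rogawski1990, §3.6 p. 31] -/
theorem trace_eq_add_of_mul_eigenframe_two {M : Matrix (Fin 2) (Fin 2) K} (P : GL (Fin 2) K) {d : Fin 2 → K}
    (h : M * (P : Matrix (Fin 2) (Fin 2) K) = (P : Matrix (Fin 2) (Fin 2) K) * diagonal d) : M.trace = d 0 + d 1 := by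
  have hM : M = (P : Matrix (Fin 2) (Fin 2) K) * diagonal d * ((P⁻¹ : GL (Fin 2) K) : Matrix (Fin 2) (Fin 2) K) := by
    rw [← h, Matrix.mul_assoc, ← Units.val_mul, mul_inv_cancel, Units.val_one, Matrix.mul_one]
  rw [hM, Matrix.trace_mul_cycle, ← Units.val_mul, inv_mul_cancel, Units.val_one, Matrix.one_mul, Matrix.trace_diagonal, Fin.sum_univ_two]

omit [DecidableEq n] in
/-- **The hyperbolic pairing in coordinates**: for `M ∈ U(σ, Φ₂)`, `Φ₂ = antidiag(1, 1)`, and all `v w`: `⟨M v, M w⟩ = ⟨v, w⟩` with `⟨v, w⟩ = σ(v₀) w₁ + σ(v₁) w₀`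
(written in the shape of ★ `HermitianPlane.form_eq_zero_of_unitary_transvection`, `b = 1`). [cite: Rogawski1990, §3.5 p. 29] [cite: Flicker1998UnitaryFL, §6 p. 97] -/
theorem form_mulVec_eq_of_mem_unitaryGroup {M : GL (Fin 2) K}
    (hM : M ∈ unitaryGroup σ (Matrix.of fun i j : Fin 2 => if i.val + j.val + 1 = 2 then (1 : K) else 0)) (v w : Fin 2 → K) :
    σ (((M : Matrix (Fin 2) (Fin 2) K) *ᵥ v) 0) * (1 : K) * ((M : Matrix (Fin 2) (Fin 2) K) *ᵥ w) 1 +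
        σ (((M : Matrix (Fin 2) (Fin 2) K) *ᵥ v) 1) * σ (1 : K) * ((M : Matrix (Fin 2) (Fin 2) K) *ᵥ w) 0 =
      σ (v 0) * (1 : K) * w 1 + σ (v 1) * σ (1 : K) * w 0 := by
  have h := mem_unitaryGroup_iff.1 hM
  have e00 := congrFun (congrFun h 0) 0
  have e01 := congrFun (congrFun h 0) 1
  have e10 := congrFun (congrFun h 1) 0
  have e11 := congrFun (congrFun h 1) 1
  norm_num [Matrix.mul_apply, Fin.sum_univ_two, Matrix.of_apply] at e00 e01 e10 e11
  simp only [Matrix.mulVec, dotProduct, Fin.sum_univ_two, map_add, map_mul, map_one, mul_one]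
  linear_combination (σ (v 0) * w 0) * e00 + (σ (v 0) * w 1) * e01 + (σ (v 1) * w 0) * e10 + (σ (v 1) * w 1) * e11

end Frame

/-! ## §2 Valuation bookkeeping: unit eigenvalues; `Φ₂`, unit diagonals and integral companions lie in `GL₂(𝒪)` -/

section Valuation

variable [ValuativeRel K]

/-- `a² = d` with `|d| = 1` ⟹ `|a| = 1`. [cite: Serre1980Trees, Ch. II §1.2] -/
theorem valuation_eq_one_of_mul_self_eq {a d : K} (h : a * a = d) (hd : valuation K d = 1) : valuation K a = 1 := by
  have h2 : valuation K a * valuation K a = 1 := by rw [← map_mul, h, hd]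
  rcases lt_trichotomy (valuation K a) 1 with hlt | heq | hgt
  · exact absurd h2 (mul_lt_one' hlt hlt).ne
  · exact heq
  · exact absurd h2 (one_lt_mul'' hgt hgt).ne'

/-- **The roots of an integral quadratic with unit constant term are units**: `a + c = t`, `a c = d`, `|t| ≤ 1`, `|d| = 1` ⟹ `|a| = |c| = 1` (if `|a| > 1` then
`|c| = |t − a| = |a|` and `|d| > 1`; so both are `≤ 1` with product `1`). [cite: Serre1980Trees, Ch. II §1.2] -/
theorem valuation_eq_one_of_add_eq_of_mul_eq {a c t d : K} (hac : a + c = t) (had : a * c = d) (ht : valuation K t ≤ 1) (hd : valuation K d = 1) :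
    valuation K a = 1 ∧ valuation K c = 1 := by
  have hprod : valuation K a * valuation K c = 1 := by rw [← map_mul, had, hd]
  have hle : ∀ x y : K, x + y = t → valuation K x * valuation K y = 1 → valuation K x ≤ 1 := by
    intro x y hxy hp
    by_contra hx
    rw [not_le] at hx
    have hy : valuation K y = valuation K x := by
      rw [show y = -x + t by rw [← hxy]; ring, Valuation.map_add_eq_of_lt_left _ (by rw [Valuation.map_neg]; exact lt_of_le_of_lt ht hx),
        Valuation.map_neg]
    rw [hy] at hp
    exact (one_lt_mul'' hx hx).ne' hp
  have ha := hle a c hac hprod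
  have hc := hle c a (by rw [add_comm]; exact hac) (by rw [mul_comm]; exact hprod)
  have ha1 : valuation K a = 1 := by
    by_contra hne
    have hlt := lt_of_le_of_ne ha hne
    have h1 : valuation K a * valuation K c < 1 :=
      calc valuation K a * valuation K c ≤ valuation K a * 1 := mul_le_mul_right hc _
        _ = valuation K a := mul_one _
        _ < 1 := hlt
    exact h1.ne hprod
  refine ⟨ha1, ?_⟩
  rwa [ha1, one_mul] at hprod

/-- **Unit eigenvalues**: `γ P = P · diag(u)` with `|tr γ| ≤ 1`, `|det γ| = 1` ⟹ `|u_i| = 1`. [cite: Serre1980Trees, Ch. II §1.2] [cite: Rogawski1990, §4.9 Lemma 4.9.3 p. 61] -/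
theorem valuation_eq_one_of_eigenframe {M : Matrix (Fin 2) (Fin 2) K} (P : GL (Fin 2) K) {u : Fin 2 → K}
    (hP : M * (P : Matrix (Fin 2) (Fin 2) K) = (P : Matrix (Fin 2) (Fin 2) K) * diagonal u) (htr : valuation K M.trace ≤ 1)
    (hdet : valuation K M.det = 1) (i : Fin 2) : valuation K (u i) = 1 := by
  have h := valuation_eq_one_of_add_eq_of_mul_eq (trace_eq_add_of_mul_eigenframe_two P hP).symm (det_eq_mul_of_mul_eigenframe_two P hP).symm htr hdet
  fin_cases i
  exacts [h.1, h.2]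

/-- **`Φ₂ = antidiag(1, 1) ∈ GL₂(𝒪)`** (entries `0, 1`, determinant `−1`): the standard lattice `𝒪²` is self-dual. [cite: Jacobowitz1962, §7] [cite: Rogawski1990, §3.1 p. 19] -/
theorem exists_mem_glInt_coe_eq_antidiag :
    ∃ J' ∈ glInt 2 K, (J' : Matrix (Fin 2) (Fin 2) K) = Matrix.of fun i j : Fin 2 => if i.val + j.val + 1 = 2 then (1 : K) else 0 := by
  have hdet : (Matrix.of fun i j : Fin 2 => if i.val + j.val + 1 = 2 then (1 : K) else 0).det ≠ 0 := by
    rw [Matrix.det_fin_two]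
    simp [Matrix.of_apply]
  refine ⟨Matrix.GeneralLinearGroup.mkOfDetNeZero _ hdet, mem_glInt_of_isIntegralMatrix (fun i j => ?_) ?_, Matrix.GeneralLinearGroup.val_mkOfDetNeZero _ hdet⟩
  · rw [Matrix.GeneralLinearGroup.val_mkOfDetNeZero, Matrix.of_apply]
    split_ifs
    · exact (𝒪[K]).one_mem
    · exact (𝒪[K]).zero_mem
  · rw [Matrix.GeneralLinearGroup.val_mkOfDetNeZero, Matrix.det_fin_two]
    simp [Matrix.of_apply]

/-- **A diagonal matrix with unit entries lies in `GL₂(𝒪)`.** [cite: Serre1980Trees, Ch. II §1.2] -/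
theorem mem_glInt_of_coe_eq_diagonal_of_valuation_eq_one {g : GL (Fin 2) K} {u : Fin 2 → K} (hg : (g : Matrix (Fin 2) (Fin 2) K) = diagonal u)
    (hu : ∀ i, valuation K (u i) = 1) : g ∈ glInt 2 K := by
  refine mem_glInt_of_isIntegralMatrix (fun i j => ?_) ?_
  · rw [hg, diagonal_apply]
    split_ifs
    · exact (Valuation.mem_integer_iff _ _).2 (hu i).le
    · exact (𝒪[K]).zero_mem
  · rw [hg, det_diagonal, Fin.prod_univ_two, map_mul, hu 0, hu 1, mul_one]

/-- **The companion matrix `[[0, −d], [1, t]]` with `t ∈ 𝒪`, `|d| = 1` lies in `GL₂(𝒪)`** (the cyclic lattice `𝒪[γ] · v` of an integral `γ`). [cite: Serre1980Trees, Ch. II §1.2] -/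
theorem mem_glInt_of_coe_eq_companion {g : GL (Fin 2) K} {t d : K} (hg : (g : Matrix (Fin 2) (Fin 2) K) = !![0, -d; 1, t]) (ht : t ∈ 𝒪[K])
    (hd : valuation K d = 1) : g ∈ glInt 2 K := by
  have hdO : d ∈ 𝒪[K] := (Valuation.mem_integer_iff _ _).2 hd.le
  refine mem_glInt_of_isIntegralMatrix (fun i j => ?_) ?_
  · rw [hg]
    fin_cases i <;> fin_cases j
    · exact (𝒪[K]).zero_mem
    · exact (𝒪[K]).neg_mem hdO
    · exact (𝒪[K]).one_mem
    · exact ht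
  · rw [hg, Matrix.det_fin_two_of, zero_mul, mul_one, zero_sub, neg_neg, hd]

/-- **The `ϖ^e`-rescaled anti-diagonal Gram matrix**: `|β| = |ϖ^e|`, `σ` valuation-preserving and fixing `ϖ` ⟹ `antidiag(β, σβ) = ϖ^e • J′` with `J′ ∈ GL₂(𝒪)`
(`J′ = antidiag(β ϖ^{−e}, σ(β ϖ^{−e}))`, unit entries). [cite: Jacobowitz1962, §7] [cite: Rogawski1990, §3.6 p. 31] -/
theorem exists_mem_glInt_smul_coe_eq_antidiag (hσv : ∀ x, valuation K (σ x) = valuation K x) {ϖ : K} (hσϖ : σ ϖ = ϖ) (hϖ0 : ϖ ≠ 0) {β : K} {e : ℕ}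
    (hβ : valuation K β = valuation K (ϖ ^ e)) :
    ∃ J' ∈ glInt 2 K, ϖ ^ e • (J' : Matrix (Fin 2) (Fin 2) K) = !![0, β; σ β, 0] := by
  obtain ⟨π, hπ⟩ : ∃ π : K, π = ϖ ^ e := ⟨_, rfl⟩
  have hπ0 : π ≠ 0 := by rw [hπ]; exact pow_ne_zero e hϖ0
  have hσπ : σ π = π := by rw [hπ, map_pow, hσϖ]
  rw [← hπ] at hβ ⊢
  have hb1 : valuation K (β * π⁻¹) = 1 := by
    rw [map_mul, map_inv₀, hβ, mul_inv_cancel₀ ((Valuation.ne_zero_iff _).2 hπ0)]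
  have hbO : β * π⁻¹ ∈ 𝒪[K] := (Valuation.mem_integer_iff _ _).2 hb1.le
  have hσbO : σ (β * π⁻¹) ∈ 𝒪[K] := (Valuation.mem_integer_iff _ _).2 (by rw [hσv]; exact hb1.le)
  have hb0 : β * π⁻¹ ≠ 0 := fun h => by
    rw [h, map_zero] at hb1
    exact zero_ne_one hb1
  have hdet : (!![0, β * π⁻¹; σ (β * π⁻¹), 0] : Matrix (Fin 2) (Fin 2) K).det ≠ 0 := by
    rw [Matrix.det_fin_two_of, zero_mul, zero_sub, neg_ne_zero]
    exact mul_ne_zero hb0 ((map_ne_zero σ).2 hb0)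
  refine ⟨Matrix.GeneralLinearGroup.mkOfDetNeZero _ hdet, mem_glInt_of_isIntegralMatrix (fun i j => ?_) ?_, ?_⟩
  · rw [Matrix.GeneralLinearGroup.val_mkOfDetNeZero]
    fin_cases i <;> fin_cases j
    · exact (𝒪[K]).zero_mem
    · exact hbO
    · exact hσbO
    · exact (𝒪[K]).zero_mem
  · rw [Matrix.GeneralLinearGroup.val_mkOfDetNeZero, Matrix.det_fin_two_of, zero_mul, zero_sub, Valuation.map_neg, map_mul, hσv, hb1, mul_one]
  · rw [Matrix.GeneralLinearGroup.val_mkOfDetNeZero]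
    have hc : ∀ y, π * (y * π⁻¹) = y := fun y => by rw [mul_comm, inv_mul_cancel_right₀ hπ0]
    ext i j
    fin_cases i <;> fin_cases j <;> simp [hσπ, hc]

/-- **THE SPLIT TORUS FIXES A SELF-DUAL VERTEX**: under the hypotheses of `exists_formCongr_eq_antidiag_of_not_normOne` and with unit eigenvalues, `g := P D` has Gram
matrix `Φ₂` and `g⁻¹ γ g = diag(u) ∈ GL₂(𝒪)`. [cite: Serre1980Trees, Ch. II §1.3] [cite: Rogawski1990, §3.6 p. 31] -/
theorem exists_formCongr_eq_antidiag_and_mem_glInt_of_not_normOne (hσσ : ∀ x, σ (σ x) = x) {H : Matrix (Fin 2) (Fin 2) K} (hH : (H.map σ)ᵀ = H)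
    (hH0 : H.det ≠ 0) {γ P : GL (Fin 2) K} {u : Fin 2 → K} (hγ : γ ∈ unitaryGroup σ H) (hP : (γ : Matrix (Fin 2) (Fin 2) K) * P = P * diagonal u)
    (hu : Function.Injective u) (hN : σ (u 0) * u 0 ≠ 1) (huv : ∀ i, valuation K (u i) = 1) :
    ∃ g : GL (Fin 2) K, formCongr σ g H = (Matrix.of fun i j : Fin 2 => if i.val + j.val + 1 = 2 then (1 : K) else 0) ∧ g⁻¹ * γ * g ∈ glInt 2 K := by
  obtain ⟨D, c, hD, hform⟩ := exists_formCongr_eq_antidiag_of_not_normOne σ hσσ hH hH0 hγ hP hu hN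
  exact ⟨P * D, hform, mem_glInt_of_coe_eq_diagonal_of_valuation_eq_one (inv_mul_mul_eq_diagonal_of_eigenframe γ P D hP hD) huv⟩

end Valuation

end Literature.NumberTheory.Automorphic

end
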